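import Literature.AlgebraicTopology.SingularHomology.LocalClassFamilies
import Literature.Topology.FourManifolds.RelFundamentalClassOfInteriorOrientation
import HarnessLib

/-!
# Gluing relative fundamental classes along a boundary connected sum (homological part)

M. Kervaire, J. Milnor, *Groups of homotopy spheres I*, Ann. of Math. 77 (1963), §2, p. 507–508:
the boundary connected sum `W = W₁ ♮ W₂` of two oriented manifolds with boundary is oriented
compatibly with `W₁` and `W₂` ("`bW = bW₁ # bW₂`" as oriented manifolds). Homologically
(A. Hatcher, *Algebraic Topology*, 2002, §3.3 p. 253 and Lemma 3.27): the relative fundamental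
classes `[Wᵢ, ∂Wᵢ]` restrict to local orientations of the open pieces `Wᵢ ∖ (half-disc)`, these
glue — after possibly one global sign on the second piece — to a local orientation of the
interior of `W`, which integrates to a relative fundamental class `[W, ∂W]` restricting to the
given local classes on both pieces.

This file proves exactly this, over ABSTRACT topological gluing data
(`NullCobordism.BCSGluing`: two open pieces `A_S ⊆ W_S`, `A_T ⊆ W_T` openly embedded in `W_U`,
jointly covering it, boundary to boundary, with connected interior overlap):

* `BCSGluing.exists_isRelFundamentalClass` — for relative fundamental classes `w_S`, `w_T` of
  `W_S`, `W_T` there are a sign `ε = ±1` and a relative fundamental class `w_U` of `W_U` whose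
  local class at `jA x` (`x ∈ A_S` interior) is the transport of `w_S|ₓ`, and at `jB y` is `ε`
  times the transport of `w_T|_y`.

The sign `ε` is pinned to `+1` by the boundary orientations in the sequel. Everything is proved;
no named facts.

## References

* M. A. Kervaire, J. W. Milnor, *Groups of homotopy spheres: I*, Ann. of Math. (2) 77 (1963),
  504–537, §2 pp. 507–508. [KervaireMilnorAnnals1963]
* A. Hatcher, *Algebraic Topology*, CUP 2002, §3.3 p. 253, Lemma 3.27. [HatcherAT2002]
-/

noncomputable section

open scoped Manifold ContDiff Topology
open Set Function CategoryTheory CategoryTheory.Limits Topology TopologicalSpace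
open Literature.AlgebraicTopology.SingularHomology

namespace Literature.Topology.FourManifolds

/-! ### Generators of infinite cyclic groups differ by a sign -/

/-- Two generators of a `ℤ`-module isomorphic to `ℤ` differ by a unit. [folklore] -/
theorem exists_units_smul_of_generators {N : Type*} [AddCommGroup N] [Module ℤ N] {b b' : N}
    (hb : ∃ e : N ≃ₗ[ℤ] ℤ, e b = 1) (hb' : ∃ e : N ≃ₗ[ℤ] ℤ, e b' = 1) :
    ∃ u : ℤˣ, b = (u : ℤ) • b' := by
  obtain ⟨e, he⟩ := hb
  obtain ⟨e', he'⟩ := hb'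
  have h1 : b = (e' b) • b' := e'.injective (by rw [map_zsmul, he', smul_eq_mul, mul_one])
  have h2 : b' = (e b') • b := e.injective (by rw [map_zsmul, he, smul_eq_mul, mul_one])
  have h3 : e' b * e b' = 1 := by
    have := congrArg e h1
    rw [map_zsmul, he, smul_eq_mul] at this
    linarith [this]
  exact ⟨Units.mkOfMulEqOne _ _ h3, by rw [Units.val_mkOfMulEqOne]; exact h1⟩

namespace NullCobordism

variable {m : ℕ}
variable {MP : Type} [TopologicalSpace MP] [ChartedSpace (EuclideanSpace ℝ (Fin (m + 1))) MP]
  [IsManifold (𝓡 (m + 1)) ∞ MP] [CompactSpace MP]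
variable {MU : Type} [TopologicalSpace MU] [ChartedSpace (EuclideanSpace ℝ (Fin (m + 1))) MU]
  [IsManifold (𝓡 (m + 1)) ∞ MU] [CompactSpace MU]

/-! ### One open piece of a glued manifold and the transport of local classes through it -/

/-- **An open piece** of the total space `W_U` of a null-cobordism coming from another
null-cobordism `cP`: an open set `A ⊆ W_P` and an open embedding `j : A → W_U` carrying boundary
points to boundary points and interior points to interior points. [folklore] -/
structure Piece (cP : NullCobordism (m + 1) MP) (cU : NullCobordism (m + 1) MU) where
  /-- the open piece of `W_P` -/
  A : Opens cP.W
  /-- its open embedding into `W_U` -/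
  j : C(A, cU.W)
  isOpenEmbedding_j : IsOpenEmbedding j
  mem_boundary_iff : ∀ x : A,
    (x : cP.W) ∈ (𝓡∂ (m + 1 + 1)).boundary cP.W ↔ j x ∈ (𝓡∂ (m + 1 + 1)).boundary cU.W

namespace Piece

variable {cP : NullCobordism (m + 1) MP} {cU : NullCobordism (m + 1) MU} (P : Piece cP cU)

/-- The inclusion of the piece into `W_P`. [folklore] -/
abbrev ι : C(P.A, cP.W) := ⟨Subtype.val, continuous_subtype_val⟩

omit [IsManifold (𝓡 (m + 1)) ∞ MP] [CompactSpace MP] [IsManifold (𝓡 (m + 1)) ∞ MU]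
  [CompactSpace MU] in
/-- The inclusion of the piece is injective. [folklore] -/
theorem ι_injective : Injective P.ι := Subtype.val_injective

omit [IsManifold (𝓡 (m + 1)) ∞ MP] [CompactSpace MP] [IsManifold (𝓡 (m + 1)) ∞ MU]
  [CompactSpace MU] in
/-- The inclusion of the (open) piece is an open embedding. [folklore] -/
theorem isOpenEmbedding_ι : IsOpenEmbedding P.ι := P.A.isOpen.isOpenEmbedding_subtypeVal

omit [IsManifold (𝓡 (m + 1)) ∞ MP] [CompactSpace MP] [IsManifold (𝓡 (m + 1)) ∞ MU]
  [CompactSpace MU] in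
/-- The gluing map of the piece is injective. [folklore] -/
theorem j_injective : Injective P.j := P.isOpenEmbedding_j.injective

omit [IsManifold (𝓡 (m + 1)) ∞ MP] [CompactSpace MP] [IsManifold (𝓡 (m + 1)) ∞ MU]
  [CompactSpace MU] in
/-- Interior points of the piece go to interior points. [folklore] -/
theorem j_mem_interior {x : P.A} (hx : (x : cP.W) ∈ (𝓡∂ (m + 1 + 1)).interior cP.W) :
    P.j x ∈ (𝓡∂ (m + 1 + 1)).interior cU.W := by
  rw [← ModelWithCorners.compl_boundary] at hx ⊢
  exact fun h => hx ((P.mem_boundary_iff x).2 h)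

omit [IsManifold (𝓡 (m + 1)) ∞ MP] [CompactSpace MP] [IsManifold (𝓡 (m + 1)) ∞ MU]
  [CompactSpace MU] in
/-- Non-boundary points of the piece go to non-boundary points. [folklore] -/
theorem j_mem_compl_boundary {x : P.A} (hx : (x : cP.W) ∈ ((𝓡∂ (m + 1 + 1)).boundary cP.W)ᶜ) :
    P.j x ∈ ((𝓡∂ (m + 1 + 1)).boundary cU.W)ᶜ := fun h => hx ((P.mem_boundary_iff x).2 h)

/-- **The class of `w` on the piece**: `w|ₓ ∈ Hₘ₊₂(W_P | x)` pulled back to `Hₘ₊₂(A | x)` along the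
excision isomorphism of the open inclusion `A ⊆ W_P`. [folklore] -/
def pieceClass (w : relativeSingularHomology ℤ ℤ cP.W ((𝓡∂ (m + 1 + 1)).boundary cP.W) (m + 1 + 1))
    (x : P.A) : localHomology ℤ ℤ P.A x (m + 1 + 1) :=
  haveI := localHomology.isIso_map_of_isOpenEmbedding_of_eq ℤ ℤ P.ι P.isOpenEmbedding_ι x rfl
    (m + 1 + 1)
  inv (relativeSingularHomology.map ℤ ℤ P.ι (LocalFamily.mapsTo_compl_pt P.ι_injective x) (m + 1 + 1))
    (relLocalFamily w (x : cP.W))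

omit [IsManifold (𝓡 (m + 1)) ∞ MP] [CompactSpace MP] [IsManifold (𝓡 (m + 1)) ∞ MU]
  [CompactSpace MU] in
/-- Defining property of `pieceClass`: `ι_* (pieceClass w x) = w|ₓ`. [folklore] -/
theorem map_ι_pieceClass
    (w : relativeSingularHomology ℤ ℤ cP.W ((𝓡∂ (m + 1 + 1)).boundary cP.W) (m + 1 + 1)) (x : P.A) :
    relativeSingularHomology.map ℤ ℤ P.ι (LocalFamily.mapsTo_compl_pt P.ι_injective x) (m + 1 + 1)
      (P.pieceClass w x) = relLocalFamily w (x : cP.W) := by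
  haveI := localHomology.isIso_map_of_isOpenEmbedding_of_eq ℤ ℤ P.ι P.isOpenEmbedding_ι x rfl
    (m + 1 + 1)
  rw [pieceClass, ← ModuleCat.comp_apply, IsIso.inv_hom_id, ModuleCat.id_apply]

omit [IsManifold (𝓡 (m + 1)) ∞ MP] [CompactSpace MP] [IsManifold (𝓡 (m + 1)) ∞ MU]
  [CompactSpace MU] in
/-- `ι_* (pieceClass w x) = w|ₓ` at an interior point, with `toLocal`. [folklore] -/
theorem map_ι_pieceClass_of_mem
    (w : relativeSingularHomology ℤ ℤ cP.W ((𝓡∂ (m + 1 + 1)).boundary cP.W) (m + 1 + 1)) (x : P.A)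
    (hx : (x : cP.W) ∈ ((𝓡∂ (m + 1 + 1)).boundary cP.W)ᶜ) :
    relativeSingularHomology.map ℤ ℤ P.ι (LocalFamily.mapsTo_compl_pt P.ι_injective x) (m + 1 + 1)
      (P.pieceClass w x) =
      relativeSingularHomology.toLocal ℤ ℤ _ ⟨(x : cP.W), hx⟩ (m + 1 + 1) w := by
  rw [map_ι_pieceClass, relLocalFamily_apply w hx]

omit [IsManifold (𝓡 (m + 1)) ∞ MP] [CompactSpace MP] [IsManifold (𝓡 (m + 1)) ∞ MU]
  [CompactSpace MU] in
/-- `j` is a map of pairs `(A, A ∖ x) → (W_U, W_U ∖ z)` whenever `j x = z`. [folklore] -/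
theorem mapsTo_j_of_eq {x : P.A} {z : cU.W} (h : P.j x = z) :
    MapsTo P.j ({x}ᶜ : Set P.A) ({z}ᶜ : Set cU.W) := by
  subst h
  exact LocalFamily.mapsTo_compl_pt P.j_injective x

open Classical in
/-- **The transported family on `W_U`**: at `z = j x` the class `j_* (pieceClass w x)`, zero off
the image of the piece. [folklore] -/
def ambientFamily
    (w : relativeSingularHomology ℤ ℤ cP.W ((𝓡∂ (m + 1 + 1)).boundary cP.W) (m + 1 + 1)) :
    LocalFamily ℤ ℤ cU.W (m + 1 + 1) := fun z =>
  if h : z ∈ range P.j then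
    relativeSingularHomology.map ℤ ℤ P.j (P.mapsTo_j_of_eq h.choose_spec) (m + 1 + 1)
      (P.pieceClass w h.choose)
  else 0

omit [IsManifold (𝓡 (m + 1)) ∞ MP] [CompactSpace MP] [IsManifold (𝓡 (m + 1)) ∞ MU]
  [CompactSpace MU] in
/-- Values of the transported family on the image of the piece. [folklore] -/
theorem ambientFamily_apply
    (w : relativeSingularHomology ℤ ℤ cP.W ((𝓡∂ (m + 1 + 1)).boundary cP.W) (m + 1 + 1)) (x : P.A) :
    P.ambientFamily w (P.j x) =
      relativeSingularHomology.map ℤ ℤ P.j (LocalFamily.mapsTo_compl_pt P.j_injective x) (m + 1 + 1)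
        (P.pieceClass w x) := by
  have h : P.j x ∈ range P.j := mem_range_self x
  unfold ambientFamily
  rw [dif_pos h]
  have key : ∀ (x' : P.A) (hx' : P.j x' = P.j x)
      (hm : MapsTo P.j ({x'}ᶜ : Set P.A) ({P.j x}ᶜ : Set cU.W)),
      relativeSingularHomology.map ℤ ℤ P.j hm (m + 1 + 1) (P.pieceClass w x') =
        relativeSingularHomology.map ℤ ℤ P.j (LocalFamily.mapsTo_compl_pt P.j_injective x)
          (m + 1 + 1) (P.pieceClass w x) := by
    intro x' hx' hm
    cases P.j_injective hx'
    rfl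
  exact key h.choose h.choose_spec _

omit [IsManifold (𝓡 (m + 1)) ∞ MP] [CompactSpace MP] [IsManifold (𝓡 (m + 1)) ∞ MU]
  [CompactSpace MU] in
/-- Off the image of the piece the transported family vanishes. [folklore] -/
theorem ambientFamily_of_not_mem
    (w : relativeSingularHomology ℤ ℤ cP.W ((𝓡∂ (m + 1 + 1)).boundary cP.W) (m + 1 + 1)) {z : cU.W}
    (hz : z ∉ range P.j) : P.ambientFamily w z = 0 := by
  unfold ambientFamily
  rw [dif_neg hz]

/-- **The interior family** on the interior manifold `X_U = W_U ∖ ∂W_U`: the transported family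
pulled back along the open embedding `X_U ↪ W_U`. [folklore] -/
def interiorFamily
    (w : relativeSingularHomology ℤ ℤ cP.W ((𝓡∂ (m + 1 + 1)).boundary cP.W) (m + 1 + 1)) :
    LocalFamily ℤ ℤ cU.Interior (m + 1 + 1) := fun v =>
  haveI := cU.isIso_map_val_local v (m + 1 + 1)
  inv (relativeSingularHomology.map ℤ ℤ cU.valCM (cU.mapsTo_val_compl_singleton v) (m + 1 + 1))
    (P.ambientFamily w v.val)

omit [IsManifold (𝓡 (m + 1)) ∞ MP] [CompactSpace MP] [IsManifold (𝓡 (m + 1)) ∞ MU]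
  [CompactSpace MU] in
/-- Defining property of the interior family: `val_* (interiorFamily v) = ambientFamily v.val`.
[folklore] -/
theorem map_val_interiorFamily
    (w : relativeSingularHomology ℤ ℤ cP.W ((𝓡∂ (m + 1 + 1)).boundary cP.W) (m + 1 + 1))
    (v : cU.Interior) :
    relativeSingularHomology.map ℤ ℤ cU.valCM (cU.mapsTo_val_compl_singleton v) (m + 1 + 1)
      (P.interiorFamily w v) = P.ambientFamily w v.val := by
  haveI := cU.isIso_map_val_local v (m + 1 + 1)
  rw [interiorFamily, ← ModuleCat.comp_apply, IsIso.inv_hom_id, ModuleCat.id_apply]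

omit [IsManifold (𝓡 (m + 1)) ∞ MP] [CompactSpace MP] [IsManifold (𝓡 (m + 1)) ∞ MU]
  [CompactSpace MU] in
/-- **The interior family consists of generators over the image of the piece** when `w` is a
relative fundamental class. [folklore] -/
theorem isGenerator_interiorFamily
    {w : relativeSingularHomology ℤ ℤ cP.W ((𝓡∂ (m + 1 + 1)).boundary cP.W) (m + 1 + 1)}
    (hw : IsRelFundamentalClass ℤ ((𝓡∂ (m + 1 + 1)).boundary cP.W) w) (x : P.A)
    (hx : (x : cP.W) ∈ ((𝓡∂ (m + 1 + 1)).boundary cP.W)ᶜ) (v : cU.Interior) (hv : v.val = P.j x) :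
    ∃ e : localHomology ℤ ℤ cU.Interior v (m + 1 + 1) ≃ₗ[ℤ] ℤ, e (P.interiorFamily w v) = 1 := by
  haveI := cU.isIso_map_val_local v (m + 1 + 1)
  rw [← exists_linearEquiv_apply_eq_one_iff_of_isIso
    (relativeSingularHomology.map ℤ ℤ cU.valCM (cU.mapsTo_val_compl_singleton v) (m + 1 + 1)),
    map_val_interiorFamily]
  -- `ambientFamily (j x) = j_* (pieceClass x)` and `ι_* (pieceClass x) = w|ₓ`, a generator
  have hgen : ∃ e : localHomology ℤ ℤ P.A x (m + 1 + 1) ≃ₗ[ℤ] ℤ, e (P.pieceClass w x) = 1 := by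
    haveI := localHomology.isIso_map_of_isOpenEmbedding_of_eq ℤ ℤ P.ι P.isOpenEmbedding_ι x rfl
      (m + 1 + 1)
    rw [← exists_linearEquiv_apply_eq_one_iff_of_isIso (relativeSingularHomology.map ℤ ℤ P.ι
      (LocalFamily.mapsTo_compl_pt P.ι_injective x) (m + 1 + 1)), map_ι_pieceClass_of_mem P w x hx]
    exact hw ⟨x, hx⟩
  -- transport along `j`, with the free target point `v.val = j x`
  have hm : MapsTo P.j ({x}ᶜ : Set P.A) ({v.val}ᶜ : Set cU.W) := by
    rw [hv]; exact LocalFamily.mapsTo_compl_pt P.j_injective x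
  haveI := localHomology.isIso_map_of_isOpenEmbedding_of_eq ℤ ℤ P.j P.isOpenEmbedding_j x hv.symm
    (m + 1 + 1)
  have hval : P.ambientFamily w v.val = relativeSingularHomology.map ℤ ℤ P.j hm (m + 1 + 1)
      (P.pieceClass w x) := by
    have key : ∀ (z : cU.W) (hz : z = P.j x) (hm' : MapsTo P.j ({x}ᶜ : Set P.A) ({z}ᶜ : Set cU.W)),
        P.ambientFamily w z = relativeSingularHomology.map ℤ ℤ P.j hm' (m + 1 + 1)
          (P.pieceClass w x) := by
      intro z hz hm'
      subst hz
      exact P.ambientFamily_apply w x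
    exact key v.val hv hm
  rw [hval]
  exact (exists_linearEquiv_apply_eq_one_iff_of_isIso _ _).2 hgen

omit [IsManifold (𝓡 (m + 1)) ∞ MP] [CompactSpace MP] [IsManifold (𝓡 (m + 1)) ∞ MU]
  [CompactSpace MU] in
/-- **The interior family is consistent near every point over the image of the interior of the
piece** (transport of the consistency of `z ↦ w|_z` through the excisions and `j`). [folklore] -/
theorem consistentOn_interiorFamily_nhds
    (w : relativeSingularHomology ℤ ℤ cP.W ((𝓡∂ (m + 1 + 1)).boundary cP.W) (m + 1 + 1)) (x : P.A)
    (hx : (x : cP.W) ∈ (𝓡∂ (m + 1 + 1)).interior cP.W) (v : cU.Interior) (hv : v.val = P.j x) :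
    ∃ N ∈ 𝓝 v, (P.interiorFamily w).ConsistentOn N := by
  -- a compact neighbourhood `K` of `x` inside `A ∩ interior`
  have hU₀ : ((P.A : Set cP.W) ∩ (𝓡∂ (m + 1 + 1)).interior cP.W) ∈ 𝓝 (x : cP.W) :=
    (P.A.isOpen.inter (InteriorManifold.isOpen_interior_carrier (I := 𝓡∂ (m + 1 + 1))
      (M := cP.W))).mem_nhds ⟨x.2, hx⟩
  obtain ⟨K, hKn, hKU, hKc⟩ := local_compact_nhds hU₀
  have hKA : K ⊆ (P.A : Set cP.W) := fun z hz => (hKU hz).1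
  have hKint : K ⊆ ((𝓡∂ (m + 1 + 1)).boundary cP.W)ᶜ := fun z hz => by
    rw [ModelWithCorners.compl_boundary]; exact (hKU hz).2
  -- (1) `z ↦ w|_z` is consistent on `K`
  have h1 : (relLocalFamily w).ConsistentOn K := consistentOn_relLocalFamily w hKint
  -- (2) pull back to the piece along `ι`
  set K' : Set P.A := Subtype.val ⁻¹' K with hK'
  have hιK' : P.ι '' K' = K := by
    ext z; constructor
    · rintro ⟨y, hy, rfl⟩; exact hy
    · intro hz; exact ⟨⟨z, hKA hz⟩, hz, rfl⟩
  have hKclosed : IsClosed K := hKc.isClosed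
  have h2 : LocalFamily.ConsistentOn (P.pieceClass w) K' := by
    refine LocalFamily.ConsistentOn.preimage_of_isOpenEmbedding (β := relLocalFamily w) P.ι
      P.isOpenEmbedding_ι ?_ ?_ ?_
    · rw [hιK', hKclosed.closure_eq]
      rintro z hz
      exact ⟨⟨z, hKA hz⟩, rfl⟩
    · rw [hιK']; exact h1
    · intro x' _
      exact (P.map_ι_pieceClass w x').symm
  -- (3) push forward along `j`
  have h3 : (P.ambientFamily w).ConsistentOn (P.j '' K') :=
    h2.image P.j P.j_injective fun x' _ => P.ambientFamily_apply w x'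
  -- (4) pull back to the interior manifold along `val`
  have hjK'int : P.j '' K' ⊆ (𝓡∂ (m + 1 + 1)).interior cU.W := by
    rintro _ ⟨x', hx', rfl⟩
    exact P.j_mem_interior (by
      have := hKint hx'
      rwa [ModelWithCorners.compl_boundary] at this)
  set K'' : Set cU.Interior := InteriorManifold.val ⁻¹' (P.j '' K') with hK''
  have hvalK'' : cU.valCM '' K'' = P.j '' K' := by
    ext z; constructor
    · rintro ⟨u, hu, rfl⟩; exact hu
    · intro hz; exact ⟨⟨z, hjK'int hz⟩, hz, rfl⟩
  have hK'c : IsCompact K' := by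
    rw [P.isOpenEmbedding_ι.isEmbedding.isCompact_iff, show (P.ι : P.A → cP.W) '' K' = K from hιK']
    exact hKc
  have hjK'closed : IsClosed (P.j '' K') := (hK'c.image P.j.continuous).isClosed
  have h4 : (P.interiorFamily w).ConsistentOn K'' := by
    refine LocalFamily.ConsistentOn.preimage_of_isOpenEmbedding (β := P.ambientFamily w) cU.valCM
      InteriorManifold.isOpenEmbedding_val ?_ ?_ ?_
    · rw [hvalK'', hjK'closed.closure_eq]
      intro z hz
      exact ⟨⟨z, hjK'int hz⟩, rfl⟩
    · rw [hvalK'']; exact h3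
    · intro u _
      exact (P.map_val_interiorFamily w u).symm
  -- `K''` is a neighbourhood of `v`
  refine ⟨K'', ?_, h4⟩
  have hK'n : K' ∈ 𝓝 x := continuous_subtype_val.continuousAt.preimage_mem_nhds hKn
  have hjn : P.j '' K' ∈ 𝓝 (P.j x) := P.isOpenEmbedding_j.isOpenMap.image_mem_nhds hK'n
  rw [← hv] at hjn
  exact InteriorManifold.continuous_val.continuousAt.preimage_mem_nhds hjn

end Piece

/-! ### Gluing data and the glued relative fundamental class -/

variable {MS : Type} [TopologicalSpace MS] [ChartedSpace (EuclideanSpace ℝ (Fin (m + 1))) MS]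
  [IsManifold (𝓡 (m + 1)) ∞ MS] [CompactSpace MS]
variable {MT : Type} [TopologicalSpace MT] [ChartedSpace (EuclideanSpace ℝ (Fin (m + 1))) MT]
  [IsManifold (𝓡 (m + 1)) ∞ MT] [CompactSpace MT]

/-- **Boundary-connected-sum gluing data** (topological): `W_U` is covered by the open embedded
images of two pieces `A_S ⊆ W_S`, `A_T ⊆ W_T` (boundary to boundary), whose images meet the
interior of `W_U` in a nonempty preconnected set (Kervaire–Milnor 1963, §2: `W₁ ♮ W₂` is the union
of `W₁ ∖ H₁` and `W₂ ∖ H₂` overlapping in a punctured half-ball). [cite: KervaireMilnorAnnals1963, §2 pp. 507–508] -/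
structure BCSGluing (cS : NullCobordism (m + 1) MS) (cT : NullCobordism (m + 1) MT)
    (cU : NullCobordism (m + 1) MU) where
  /-- the `S`-piece -/
  S : Piece cS cU
  /-- the `T`-piece -/
  T : Piece cT cU
  union_range : range S.j ∪ range T.j = univ
  overlap_nonempty : {v : cU.Interior | v.val ∈ range S.j ∩ range T.j}.Nonempty
  isPreconnected_overlap : IsPreconnected {v : cU.Interior | v.val ∈ range S.j ∩ range T.j}

namespace BCSGluing

variable {cS : NullCobordism (m + 1) MS} {cT : NullCobordism (m + 1) MT}
  {cU : NullCobordism (m + 1) MU} (G : BCSGluing cS cT cU)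

/-- The interior overlap of the two pieces. [folklore] -/
abbrev overlap : Set cU.Interior := {v : cU.Interior | v.val ∈ range G.S.j ∩ range G.T.j}

omit [IsManifold (𝓡 (m + 1)) ∞ MU] [CompactSpace MU] [IsManifold (𝓡 (m + 1)) ∞ MS] [CompactSpace MS]
  [IsManifold (𝓡 (m + 1)) ∞ MT] [CompactSpace MT] in
/-- The interior overlap is open. [folklore] -/
theorem isOpen_overlap : IsOpen G.overlap :=
  (G.S.isOpenEmbedding_j.isOpen_range.inter G.T.isOpenEmbedding_j.isOpen_range).preimage
    InteriorManifold.continuous_val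

omit [IsManifold (𝓡 (m + 1)) ∞ MU] [CompactSpace MU] [IsManifold (𝓡 (m + 1)) ∞ MS] [CompactSpace MS]
  [IsManifold (𝓡 (m + 1)) ∞ MT] [CompactSpace MT] in
/-- A preimage point in a piece of an interior point is an interior point. [folklore] -/
theorem mem_interior_of_j_eq {MP : Type} [TopologicalSpace MP]
    [ChartedSpace (EuclideanSpace ℝ (Fin (m + 1))) MP] [IsManifold (𝓡 (m + 1)) ∞ MP] [CompactSpace MP]
    {cP : NullCobordism (m + 1) MP} (P : Piece cP cU) {x : P.A} {v : cU.Interior}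
    (hv : P.j x = v.val) : (x : cP.W) ∈ (𝓡∂ (m + 1 + 1)).interior cP.W := by
  rw [← ModelWithCorners.compl_boundary]
  intro h
  have := (P.mem_boundary_iff x).1 h
  rw [hv] at this
  exact v.val_notMem_boundary this

/-- **Homological gluing of relative fundamental classes along a boundary connected sum**
(Kervaire–Milnor 1963, §2; Hatcher 2002, p. 253): given relative fundamental classes `w_S`,
`w_T` of the pieces' sources, there are a sign `ε = ±1` and a relative fundamental class `w_U`
of `W_U` with `w_U|_{jA x} = (jA)_* (w_S|ₓ)` for interior `x ∈ A_S` and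
`w_U|_{jB y} = ε (jB)_* (w_T|_y)` for interior `y ∈ A_T` (local classes read in the pieces,
`Piece.pieceClass`). [cite: KervaireMilnorAnnals1963, §2 pp. 507–508] -/
theorem exists_isRelFundamentalClass
    {wS : relativeSingularHomology ℤ ℤ cS.W ((𝓡∂ (m + 1 + 1)).boundary cS.W) (m + 1 + 1)}
    {wT : relativeSingularHomology ℤ ℤ cT.W ((𝓡∂ (m + 1 + 1)).boundary cT.W) (m + 1 + 1)}
    (hwS : IsRelFundamentalClass ℤ ((𝓡∂ (m + 1 + 1)).boundary cS.W) wS)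
    (hwT : IsRelFundamentalClass ℤ ((𝓡∂ (m + 1 + 1)).boundary cT.W) wT) :
    ∃ (ε : ℤˣ) (wU : relativeSingularHomology ℤ ℤ cU.W ((𝓡∂ (m + 1 + 1)).boundary cU.W) (m + 1 + 1)),
      IsRelFundamentalClass ℤ ((𝓡∂ (m + 1 + 1)).boundary cU.W) wU ∧
      (∀ (x : G.S.A) (hx : (x : cS.W) ∈ ((𝓡∂ (m + 1 + 1)).boundary cS.W)ᶜ),
        relativeSingularHomology.toLocal ℤ ℤ _ ⟨G.S.j x, G.S.j_mem_compl_boundary hx⟩ (m + 1 + 1) wU =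
          relativeSingularHomology.map ℤ ℤ G.S.j (LocalFamily.mapsTo_compl_pt G.S.j_injective x)
            (m + 1 + 1) (G.S.pieceClass wS x)) ∧
      (∀ (y : G.T.A) (hy : (y : cT.W) ∈ ((𝓡∂ (m + 1 + 1)).boundary cT.W)ᶜ),
        relativeSingularHomology.toLocal ℤ ℤ _ ⟨G.T.j y, G.T.j_mem_compl_boundary hy⟩ (m + 1 + 1) wU =
          (ε : ℤ) • relativeSingularHomology.map ℤ ℤ G.T.j
            (LocalFamily.mapsTo_compl_pt G.T.j_injective y) (m + 1 + 1) (G.T.pieceClass wT y)) := by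
  classical
  set νS := G.S.interiorFamily wS with hνS
  set νT := G.T.interiorFamily wT with hνT
  -- generators and consistency of the two interior families over their pieces
  have genS : ∀ v : cU.Interior, v.val ∈ range G.S.j →
      ∃ e : localHomology ℤ ℤ cU.Interior v (m + 1 + 1) ≃ₗ[ℤ] ℤ, e (νS v) = 1 := by
    rintro v ⟨x, hx⟩
    have hxint := mem_interior_of_j_eq G.S hx
    rw [← ModelWithCorners.compl_boundary] at hxint
    exact G.S.isGenerator_interiorFamily hwS x hxint v hx.symm
  have genT : ∀ v : cU.Interior, v.val ∈ range G.T.j →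
      ∃ e : localHomology ℤ ℤ cU.Interior v (m + 1 + 1) ≃ₗ[ℤ] ℤ, e (νT v) = 1 := by
    rintro v ⟨y, hy⟩
    have hyint := mem_interior_of_j_eq G.T hy
    rw [← ModelWithCorners.compl_boundary] at hyint
    exact G.T.isGenerator_interiorFamily hwT y hyint v hy.symm
  have consS : ∀ v : cU.Interior, v.val ∈ range G.S.j → ∃ N ∈ 𝓝 v, νS.ConsistentOn N := by
    rintro v ⟨x, hx⟩
    exact G.S.consistentOn_interiorFamily_nhds wS x (mem_interior_of_j_eq G.S hx) v hx.symm
  have consT : ∀ v : cU.Interior, v.val ∈ range G.T.j → ∃ N ∈ 𝓝 v, νT.ConsistentOn N := by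
    rintro v ⟨y, hy⟩
    exact G.T.consistentOn_interiorFamily_nhds wT y (mem_interior_of_j_eq G.T hy) v hy.symm
  -- the sign function on the overlap and its constancy
  have hsign := fun (v : cU.Interior) (hv : v ∈ G.overlap) =>
    exists_units_smul_of_generators (genS v hv.1) (genT v hv.2)
  choose! εf hεf using hsign
  obtain ⟨v₀, hv₀⟩ := G.overlap_nonempty
  set ε : ℤˣ := εf v₀ with hε
  have hεconst : ∀ v ∈ G.overlap, εf v = ε := fun v hv =>
    LocalFamily.sign_eq_of_isPreconnected (EuclideanSpace ℝ (Fin (m + 1 + 1))) (β := νT) (β' := νS)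
      G.isOpen_overlap G.isPreconnected_overlap (fun u hu => consT u hu.2) (fun u hu => consS u hu.1)
      (fun u hu => genT u hu.2) (ε := εf)
      (fun u hu => (hεf u hu).trans (Int.cast_smul_eq_zsmul ℤ (εf u : ℤ) (νT u)).symm) hv hv₀
  -- the glued family
  let β : LocalFamily ℤ ℤ cU.Interior (m + 1 + 1) := fun v =>
    if v.val ∈ range G.S.j then νS v else (ε : ℤ) • νT v
  have hβS : ∀ v : cU.Interior, v.val ∈ range G.S.j → β v = νS v := fun v hv => if_pos hv
  have hβT : ∀ v : cU.Interior, v.val ∈ range G.T.j → β v = (ε : ℤ) • νT v := by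
    intro v hvT
    by_cases hvS : v.val ∈ range G.S.j
    · rw [hβS v hvS, hεf v ⟨hvS, hvT⟩, hεconst v ⟨hvS, hvT⟩]
    · exact if_neg hvS
  have hcover : ∀ v : cU.Interior, v.val ∈ range G.S.j ∨ v.val ∈ range G.T.j := fun v => by
    have : v.val ∈ range G.S.j ∪ range G.T.j := by rw [G.union_range]; exact mem_univ _
    exact this
  have hgen : ∀ v, ∃ e : localHomology ℤ ℤ cU.Interior v (m + 1 + 1) ≃ₗ[ℤ] ℤ, e (β v) = 1 := by
    intro v
    rcases hcover v with hvS | hvT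
    · rw [hβS v hvS]; exact genS v hvS
    · rw [hβT v hvT]; exact SmoothOrientation.exists_linearEquiv_units_smul (genT v hvT) ε
  have hcons : ∀ v, ∃ N ∈ 𝓝 v, LocalFamily.ConsistentOn β N := by
    intro v
    by_cases hvS : v.val ∈ range G.S.j
    · obtain ⟨N, hN, mN, hmN⟩ := consS v hvS
      have hO : InteriorManifold.val ⁻¹' range G.S.j ∈ 𝓝 v :=
        (G.S.isOpenEmbedding_j.isOpen_range.preimage InteriorManifold.continuous_val).mem_nhds hvS
      refine ⟨N ∩ InteriorManifold.val ⁻¹' range G.S.j, Filter.inter_mem hN hO,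
        restrictLocal ℤ ℤ inter_subset_left _ mN, fun u hu => ?_⟩
      rw [restrictToPoint_restrictLocal_apply, hmN u hu.1, hβS u hu.2]
    · have hvT : v.val ∈ range G.T.j := (hcover v).resolve_left hvS
      obtain ⟨N, hN, mN, hmN⟩ := consT v hvT
      have hO : InteriorManifold.val ⁻¹' range G.T.j ∈ 𝓝 v :=
        (G.T.isOpenEmbedding_j.isOpen_range.preimage InteriorManifold.continuous_val).mem_nhds hvT
      refine ⟨N ∩ InteriorManifold.val ⁻¹' range G.T.j, Filter.inter_mem hN hO,
        (ε : ℤ) • restrictLocal ℤ ℤ inter_subset_left _ mN, fun u hu => ?_⟩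
      rw [map_zsmul, restrictToPoint_restrictLocal_apply, hmN u hu.1, hβT u hu.2]
  -- the glued orientation of the interior and its relative fundamental class
  set ν := HomologicalOrientation.ofLocalFamily β hgen hcons with hν
  obtain ⟨wU, hwU, hloc⟩ := cU.exists_isRelFundamentalClass_of_interiorOrientation ν
  refine ⟨ε, wU, hwU, fun x hx => ?_, fun y hy => ?_⟩
  · -- `S`-side: `wU|_{j x} = val_* (ν v) = val_* (νS v) = ambientFamily (j x) = j_* pieceClass`
    have hxint : (x : cS.W) ∈ (𝓡∂ (m + 1 + 1)).interior cS.W := by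
      rwa [← ModelWithCorners.compl_boundary]
    set v : cU.Interior := ⟨G.S.j x, G.S.j_mem_interior hxint⟩ with hv
    refine (hloc v).trans ?_
    rw [hν, HomologicalOrientation.ofLocalFamily_localClass,
      hβS v (mem_range_self x), hνS, G.S.map_val_interiorFamily]
    exact G.S.ambientFamily_apply wS x
  · have hyint : (y : cT.W) ∈ (𝓡∂ (m + 1 + 1)).interior cT.W := by
      rwa [← ModelWithCorners.compl_boundary]
    set v : cU.Interior := ⟨G.T.j y, G.T.j_mem_interior hyint⟩ with hv
    refine (hloc v).trans ?_
    rw [hν, HomologicalOrientation.ofLocalFamily_localClass,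
      hβT v (mem_range_self y), map_zsmul, hνT, G.T.map_val_interiorFamily]
    congr 1
    exact G.T.ambientFamily_apply wT y

end BCSGluing

end NullCobordism

end Literature.Topology.FourManifolds
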